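import Mathlib
import Summits.Langlands.Langlands.Theses.SkinnerWilesDefectOne
import Literature.Algebra.Homology.GroupCohomologyCoresolutionFiniteExact
-- (not imported: farm copy of Literature.AlgebraicTopology.SingularHomology.CechNerveFunctions p113998 not built yet; names cited in docstrings only)

/-!
# Sketch (crux-ideate, ideator 2, round 1) — `BianchiCongruenceCohomologyFinite` (stmt-Langlands-15362)
# Idea `horoball-cech-coresolution`: first lemmas, typed over existing declarations (sorried).

Nothing here is proved; every statement must merely ELABORATE.  Namespace per the crux protocol.
-/

noncomputable section

set_option linter.dupNamespace false -- mandated crux namespace `Summit.Langlands.Langlands.…`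

open scoped MatrixGroups NumberField Pointwise ComplexOrder
open CategoryTheory

namespace Summit.Langlands.Langlands.Cruxes.BianchiCongruenceCohomologyFinite.HoroballCech

/-! ### (L1) The lever, abstract form: equivariant good (convex) cover ⇒ finite cohomology -/

/-- **FIRST LEMMA (engine + Leray).**  A group `G` acts linearly on a finite-dimensional real
vector space `E`, preserving an open convex set `Ω` and permuting a cover `(U i)_{i : ι}` of `Ω` by
open convex subsets (`φ g '' U i = U (g • i)`).  If in every degree `p` the ordered nerve
`{J : Fin (p+1) → ι | ⋂ U (J k) ≠ ∅}` has finitely many `G`-orbits, and every simplex stabiliser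
has finite cohomology with every finite coefficient module, then `Hⁿ(G, A)` is finite for every
finite `A : Rep ℤ G` and every `n`.  Proof plan: the Čech complex of functions on the nerve,
`0 → A → Fun(N₀, A) → Fun(N₁, A) → ⋯` (tree `CechNerve.cechFunD`, p113998), is a complex of
representations (diagonal action) and is EXACT (Leray acyclic-cover theorem for the convex cover of
the contractible `Ω`: tree `cechSingularEquiv`, `cechTheta_bijective`, Mathlib
`Convex.contractibleSpace`); `Hᵇ(G, Fun(N_p, A)) ≅ Π_{orbits} Hᵇ(G_J, A)` is finite (Shapiro over
the finitely many orbits, tree `TwistedQuotient.toOrbitCohomology_pi_bijective` pattern); conclude by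
`Literature.Algebra.Homology.finite_groupCohomology_of_exact_sequence` (p112865).
[cite: Brown1982CohomologyGroups, VII (7.10), VIII §2] [cite: BottTu1982Forms, Thm. 8.9 / 15.8] -/
theorem finite_groupCohomology_of_equivariant_convex_cover
    {E : Type} [AddCommGroup E] [Module ℝ E] [TopologicalSpace E] [IsTopologicalAddGroup E]
    [ContinuousSMul ℝ E] [T2Space E] [Module.Finite ℝ E]
    {G : Type} [Group G] {ι : Type} [MulAction G ι]
    (φ : G →* (E →L[ℝ] E))
    (Ω : Set E) (hΩo : IsOpen Ω) (hΩc : Convex ℝ Ω) (hΩn : Ω.Nonempty)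
    (U : ι → Set E) (hUo : ∀ i, IsOpen (U i)) (hUc : ∀ i, Convex ℝ (U i))
    (hUΩ : ∀ i, U i ⊆ Ω) (hcov : Ω ⊆ ⋃ i, U i)
    (hUG : ∀ (g : G) (i : ι), φ g '' U i = U (g • i))
    (hfin : ∀ p : ℕ, ∃ S : Finset (Fin (p + 1) → ι),
      ∀ J : Fin (p + 1) → ι, (⋂ k, U (J k)).Nonempty → ∃ J₀ ∈ S, ∃ g : G, g • J₀ = J)
    (hstab : ∀ (p : ℕ) (J : Fin (p + 1) → ι), (⋂ k, U (J k)).Nonempty →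
      ∀ (B : Rep ℤ (MulAction.stabilizer G J)), Finite B → ∀ q : ℕ, Finite (groupCohomology B q))
    (A : Rep ℤ G) (hA : Finite A) (n : ℕ) : Finite (groupCohomology A n) := by
  sorry

/-! ### (L2) Reduction of the crux to the single arithmetic group `GL₂(𝓞_K)` -/

/-- **The crux from `GL₂(𝓞_K)`** (rerun at `n = 2` of the in-tree chain of
`BorelSerre1973_finite_groupCohomology_congruenceSubgroup_of_glIntegers`: transport to the image in
`GL₂(K)`, `finite_groupCohomology_of_mulEquiv`, and commensurability of `Γ_U` with it,
`commensurable_comap_globalEmbedding_glIntegers`, `finite_groupCohomology_of_commensurable`).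
No torsion-free subgroup, no resolution. [cite: Brown1982CohomologyGroups, III (6.2), VIII (5.1)] -/
theorem bianchiCongruenceCohomologyFinite_of_glIntegers_two
    (h : ∀ (K : Type) [Field K] [NumberField K], Module.finrank ℚ K = 2 →
      NumberField.IsTotallyComplex K →
      ∀ (B : Rep ℤ (GL (Fin 2) (𝓞 K))), Finite B → ∀ q : ℕ, Finite (groupCohomology B q)) :
    Summit.Langlands.Langlands.Theses.SkinnerWilesDefectOne.BianchiCongruenceCohomologyFinite := by
  sorry

/-! ### (L3) The geometric model: the cone of positive binary Hermitian forms and horoball cones -/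

/-- The value `v* h v` of the Hermitian form of a matrix `h` at a complex vector `v` (real part;
it is real when `h` is Hermitian). [folklore] -/
def hermVal (h : Matrix (Fin 2) (Fin 2) ℂ) (v : Fin 2 → ℂ) : ℝ :=
  (star v ⬝ᵥ h.mulVec v).re

/-- The cone `Ω` of positive definite binary Hermitian forms (`≅ ℍ³ × ℝ_{>0}`). [folklore] -/
def posCone : Set (Matrix (Fin 2) (Fin 2) ℂ) := {h | h.PosDef}

/-- The **horoball cone** of the vector `v` at parameter `t`: forms taking a value `< t √det` at
`v` (for `det h = 1` these are the points of the horoball at the cusp `[v]` of `ℍ³`).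
[cite: Grayson1984ReductionSemistability, §1–§2 (canonical filtration, rank one)] -/
def horoballCone (v : Fin 2 → ℂ) (t : ℝ) : Set (Matrix (Fin 2) (Fin 2) ℂ) :=
  {h | h.PosDef ∧ hermVal h v < t * Real.sqrt (h.det).re}

/-- `Ω` is convex (and open) in the real vector space of `2 × 2` complex matrices. [folklore] -/
theorem convex_posCone : Convex ℝ posCone := by
  sorry

/-- **Horoball cones are convex** — `h ↦ h(v)` is linear and `√det` is concave on positive
definite binary Hermitian forms (`det` is a quadratic form of signature `(1,3)` on `Herm₂(ℂ)` and
`Ω` is the interior of its future cone: reverse Cauchy–Schwarz). [folklore] -/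
theorem convex_horoballCone (v : Fin 2 → ℂ) (t : ℝ) : Convex ℝ (horoballCone v t) := by
  sorry

/-- The action of `GL₂` on forms, `(g · h)(w) = h(g⁻¹ w)`, i.e. `g · h = (g⁻¹)ᴴ h g⁻¹`, maps the
horoball cone of `v` onto the horoball cone of `g v` when `|det g| = 1` (units of an imaginary
quadratic field are roots of unity). [folklore] -/
theorem image_horoballCone (g : GL (Fin 2) ℂ) (hg : ‖(g.det : ℂ)‖ = 1) (v : Fin 2 → ℂ) (t : ℝ) :
    (fun h : Matrix (Fin 2) (Fin 2) ℂ => (g⁻¹ : GL (Fin 2) ℂ).val.conjTranspose * h * (g⁻¹).val) ''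
        horoballCone v t = horoballCone (g.val.mulVec v) t := by
  sorry

/-! ### (L4) Arithmetic inputs: Hermite (covering), Hadamard (local finiteness), finite tori -/

/-- **Hermite bound over `K` — the horoball cones cover `Ω`**: there is `t = t(K) > 0` such that
every positive definite binary Hermitian form takes a value `< t √det h` at a non-zero vector of
`𝓞_K²` (Minkowski's convex-body theorem in `ℂ² ≅ ℝ⁴` for the lattice `𝓞_K²`, Mathlib
`MeasureTheory.exists_ne_zero_mem_lattice_of_measure_mul_two_pow_lt_measure`; `t² ≍ |d_K|`).
[cite: Brown1982CohomologyGroups, VIII.9 Example 5 (reduction theory input)] -/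
theorem exists_hermite_const (K : Type) [Field K] [NumberField K] (φ : K →+* ℂ)
    (h2 : Module.finrank ℚ K = 2) (hK : NumberField.IsTotallyComplex K) :
    ∃ t : ℝ, 0 < t ∧ ∀ h : Matrix (Fin 2) (Fin 2) ℂ, h.PosDef →
      ∃ v : Fin 2 → 𝓞 K, v ≠ 0 ∧ hermVal h (fun i => φ (v i : K)) < t * Real.sqrt (h.det).re := by
  sorry

/-- **Hadamard's inequality — two horoball cones meet only at bounded determinant**:
`|det(v,w)|² · det h ≤ h(v) · h(w)` for `h` positive definite; hence
`h ∈ horoballCone v t ∩ horoballCone w t ⇒ |det(v,w)| < t`, which with the discreteness of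
`𝓞_K ⊂ ℂ` gives finitely many orbits of nerve simplices in each degree. [folklore] -/
theorem normSq_det_mul_det_le (h : Matrix (Fin 2) (Fin 2) ℂ) (hh : h.PosDef) (v w : Fin 2 → ℂ) :
    Complex.normSq (Matrix.det (Matrix.of ![v, w])) * (h.det).re ≤ hermVal h v * hermVal h w := by
  sorry

/-- **Stabilisers of two independent cusps are finite** (this is where "imaginary quadratic"
bites: such a `g` is diagonal in the basis `(v, w)` with eigenvalues in `𝓞_K^×`, a finite group of
roots of unity, `NumberField.Units` of a field with `rank = 0`). [folklore] -/
theorem finite_fixing_two_lines (K : Type) [Field K] [NumberField K]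
    (hK : NumberField.IsTotallyComplex K) (h2 : Module.finrank ℚ K = 2)
    (v w : Fin 2 → K) (hvw : LinearIndependent K ![v, w]) :
    Set.Finite {g : GL (Fin 2) (𝓞 K) |
      (∃ a : K, ((g : Matrix (Fin 2) (Fin 2) (𝓞 K)).map (algebraMap (𝓞 K) K)).mulVec v = a • v) ∧
      (∃ b : K, ((g : Matrix (Fin 2) (Fin 2) (𝓞 K)).map (algebraMap (𝓞 K) K)).mulVec w = b • w)} := by
  sorry

/-- **Cusp groups have finite cohomology with finite coefficients** — the model case `ℤ²`
(Koszul resolution `0 → ℤ[ℤ²] → ℤ[ℤ²]² → ℤ[ℤ²] → ℤ → 0`; the stabiliser of one cusp in `GL₂(𝓞_K)`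
is an extension of a finite group by a lattice `≅ ℤ²` in `K`, and finiteness ascends by the tree's
`finite_groupCohomology_of_finiteIndex`). [cite: Brown1982CohomologyGroups, VIII §2] -/
theorem finite_groupCohomology_intLatticeTwo
    (B : Rep ℤ (Multiplicative (Fin 2 → ℤ))) (hB : Finite B) (q : ℕ) :
    Finite (groupCohomology B q) := by
  sorry

end Summit.Langlands.Langlands.Cruxes.BianchiCongruenceCohomologyFinite.HoroballCech
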